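import Mathlib
import HarnessLib

/-!
# ζ(5) search — Families: Brown–Zudilin's leading coefficient as a POLYNOMIAL COEFFICIENT — the 12-parameter
# family `G(e,t)` and its seven Pascal relations

HONEST FRAMING: systematic search; no irrationality claim unless certified.  Cell `pub-zeta5`, certifier 2
(cert-2 g8, 2026-08-22).  Identities between integers (coefficients of integer polynomials); no conjecture node is
used; nothing about `ζ(5)`; no number of record moves.

WHAT.  In five variables `x = (z, z', v, y, y')` (indices `0,…,4` of `Fin 5`) consider the seven polynomials
`F₁ = 1+v`, `F₂ = 1+z`, `F₃ = 1+z'`, `F₄ = 1+y`, `F₅ = 1+y'`, `F₆ = 1+y(1+z)(1+v)`, `F₇ = 1+y'(1+z')(1+v)`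
(`qFactor 0 … qFactor 6`) and, for `e ∈ ℕ⁷` and `t ∈ ℤ⁵`,
  `G(e,t) := [x^t] F₁^{e₁} ⋯ F₇^{e₇}`   (`DualQ.G e t`; `0` if some `t_j < 0`).
CLAIM (cert-2 g8, exact numerics 544/544 on Brown–Zudilin's cone, `HOME/cert-2/g8`): for `a` in the cone of
CONJECTURE D-exact (`Families/DualConstantTerm`) with `m = a₃−a₅+a₇ ≥ 0` (0-based `a`),
  `|Q(a)| = G(e(a), t(a))`,  `e(a) = (a₃+a₆+2a₇−a₁−a₂−a₅, a₅, a₆, a₃, a₁, a₄, a₀)`,  `t(a) = (B₇, B₃, m, B₅, B₁)` (`B = bzDen a`),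
and more generally Brown–Zudilin's unsigned double sum `|Q(p;q)|` of [BrownZudilin2022, (17)] is `G(e,t)` under the
unimodular dictionary `e = (q₃−p₀−p₆+p₂+p₄, p₂, p₄, q₁, q₅, q₂, q₄)`, `t = (p₀, p₆, p₃+q₃−p₀−p₆, q₁+p₁−p₂, q₅+p₅−p₄)`
(the bridge to the tree's `BrownZudilin2022.QOf` is filed separately).  THIS FILE proves the algebra of `G` only:
* `coeffZ` (coefficient at an integer exponent vector) with `coeffZ_add`, `coeffZ_X_mul` (shift), `coeffZ_one`;
* `qPoly`, `G`, and the seven PASCAL RELATIONS `G_succ0 … G_succ6`: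
  `G(e+u_i, t) = G(e, t) + G(e + σ_i, t − τ_i)` — `F_i^{e+1} = F_i^e + (F_i − 1)F_i^e` with `F_i − 1` a monomial times
  other factors (`σ₆ = u₁+u₂`, `σ₇ = u₁+u₃`, else `0`; `τ_i` the unit vector of the variable of `F_i − 1`);
* `G_zero : G(0,t) = [t = 0]`.
These are the `Q`-side inputs of cert-2 g8's 12-parameter form of CONJECTURE D-exact (the `CT`-side relations are the
Plücker three-term identities among span products; plan `HOME/cert-2/g8/DEXACT12.md`).
-/

noncomputable section

open MvPolynomial Finset

namespace Summit.KontsevichZagierPeriods.Zeta5Search.Families.Cellular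

namespace DualQ

/-- The polynomial ring `ℤ[z, z', v, y, y']` (variables `0,…,4`). -/
abbrev P5 := MvPolynomial (Fin 5) ℤ

/-- The seven factors `F₁,…,F₇` (indexed `0,…,6`): `1+v, 1+z, 1+z', 1+y, 1+y', 1+y(1+z)(1+v), 1+y'(1+z')(1+v)`. -/
def qFactor (i : Fin 7) : P5 :=
  if i = 0 then 1 + X 2 else if i = 1 then 1 + X 0 else if i = 2 then 1 + X 1 else if i = 3 then 1 + X 3
  else if i = 4 then 1 + X 4 else if i = 5 then 1 + X 3 * (1 + X 0) * (1 + X 2) else 1 + X 4 * (1 + X 1) * (1 + X 2)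

/-- The product `F₁^{e₁} ⋯ F₇^{e₇}`. -/
def qPoly (e : Fin 7 → ℕ) : P5 :=
  qFactor 0 ^ e 0 * qFactor 1 ^ e 1 * qFactor 2 ^ e 2 * qFactor 3 ^ e 3 * qFactor 4 ^ e 4 * qFactor 5 ^ e 5 *
    qFactor 6 ^ e 6

/-- The coefficient of `x^t` for an INTEGER exponent vector `t` (`0` if some `t_j < 0`). -/
def coeffZ (t : Fin 5 → ℤ) (p : P5) : ℤ :=
  if ∀ j, 0 ≤ t j then coeff (Finsupp.equivFunOnFinite.symm fun j => (t j).toNat) p else 0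

/-- **`G(e,t) = [x^t] F^e`**, the 12-parameter coefficient family. -/
def G (e : Fin 7 → ℕ) (t : Fin 5 → ℤ) : ℤ := coeffZ t (qPoly e)

/-- The unit vector `u_k ∈ ℤ⁵`. -/
def tUnit (k : Fin 5) : Fin 5 → ℤ := fun j => if j = k then 1 else 0

/-! ## The coefficient functional `coeffZ` -/

/-- Additivity. -/
theorem coeffZ_add (t : Fin 5 → ℤ) (p q : P5) : coeffZ t (p + q) = coeffZ t p + coeffZ t q := by
  unfold coeffZ
  split_ifs <;> simp

/-- **Shift**: `[x^t](x_k · p) = [x^{t − u_k}] p` (both sides `0` off the orthant). -/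
theorem coeffZ_X_mul (t : Fin 5 → ℤ) (k : Fin 5) (p : P5) : coeffZ t (X k * p) = coeffZ (t - tUnit k) p := by
  unfold coeffZ
  by_cases h : ∀ j, 0 ≤ t j
  · rw [if_pos h, coeff_X_mul']
    by_cases hk : 1 ≤ t k
    · have h' : ∀ j, 0 ≤ (t - tUnit k) j := by
        intro j
        simp only [Pi.sub_apply, tUnit]
        split_ifs with hj
        · subst hj; omega
        · have := h j; omega
      rw [if_pos h']
      have hs : k ∈ (Finsupp.equivFunOnFinite.symm fun j => (t j).toNat).support := by
        rw [Finsupp.mem_support_iff, Finsupp.coe_equivFunOnFinite_symm]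
        omega
      rw [if_pos hs]
      congr 1
      ext j
      simp only [Finsupp.coe_tsub, Pi.sub_apply, Finsupp.coe_equivFunOnFinite_symm, Finsupp.single_apply, tUnit]
      by_cases hj : k = j
      · subst hj; simp only [if_true]; omega
      · rw [if_neg hj, if_neg (Ne.symm hj)]; omega
    · have hk0 : t k = 0 := by have := h k; omega
      have hs : k ∉ (Finsupp.equivFunOnFinite.symm fun j => (t j).toNat).support := by
        rw [Finsupp.mem_support_iff, Finsupp.coe_equivFunOnFinite_symm, not_not]
        omega
      rw [if_neg hs]
      have h' : ¬ ∀ j, 0 ≤ (t - tUnit k) j := by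
        intro h'
        have := h' k
        simp only [Pi.sub_apply, tUnit, if_true] at this
        omega
      rw [if_neg h']
  · rw [if_neg h]
    have h' : ¬ ∀ j, 0 ≤ (t - tUnit k) j := by
      intro h'
      apply h
      intro j
      have := h' j
      simp only [Pi.sub_apply, tUnit] at this
      split_ifs at this <;> omega
    rw [if_neg h']

/-- `[x^t] 1 = [t = 0]`. -/
theorem coeffZ_one (t : Fin 5 → ℤ) : coeffZ t 1 = if t = 0 then 1 else 0 := by
  unfold coeffZ
  by_cases h : ∀ j, 0 ≤ t j
  · rw [if_pos h, coeff_one]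
    by_cases ht : t = 0
    · subst ht
      rw [if_pos rfl, if_pos]
      ext j; simp
    · rw [if_neg ht, if_neg]
      intro h0
      apply ht
      funext j
      have hj := congrArg (fun f => f j) h0
      simp only [Finsupp.coe_zero, Pi.zero_apply, Finsupp.coe_equivFunOnFinite_symm] at hj
      have := h j
      simp only [Pi.zero_apply]
      omega
  · rw [if_neg h, if_neg]
    rintro rfl
    exact h fun j => le_refl _

/-! ## The seven Pascal relations -/

/-- `F_i^{e_i+1}`-bookkeeping: `qPoly (e + u_i) = qPoly e * qFactor i`. -/
theorem qPoly_update (e : Fin 7 → ℕ) (i : Fin 7) :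
    qPoly (Function.update e i (e i + 1)) = qPoly e * qFactor i := by
  unfold qPoly
  fin_cases i <;> simp [Function.update, pow_succ] <;> ring

/-- **Pascal 1** (`F₁ = 1 + v`): `G(e+u₁, t) = G(e, t) + G(e, t − u_v)`. -/
theorem G_succ0 (e : Fin 7 → ℕ) (t : Fin 5 → ℤ) :
    G (Function.update e 0 (e 0 + 1)) t = G e t + G e (t - tUnit 2) := by
  unfold G
  rw [qPoly_update, show qFactor 0 = 1 + X 2 by rfl, mul_add, mul_one, coeffZ_add, mul_comm, coeffZ_X_mul]

/-- **Pascal 2** (`F₂ = 1 + z`): `G(e+u₂, t) = G(e, t) + G(e, t − u_z)`. -/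
theorem G_succ1 (e : Fin 7 → ℕ) (t : Fin 5 → ℤ) :
    G (Function.update e 1 (e 1 + 1)) t = G e t + G e (t - tUnit 0) := by
  unfold G
  rw [qPoly_update, show qFactor 1 = 1 + X 0 by rfl, mul_add, mul_one, coeffZ_add, mul_comm, coeffZ_X_mul]

/-- **Pascal 3** (`F₃ = 1 + z'`): `G(e+u₃, t) = G(e, t) + G(e, t − u_{z'})`. -/
theorem G_succ2 (e : Fin 7 → ℕ) (t : Fin 5 → ℤ) :
    G (Function.update e 2 (e 2 + 1)) t = G e t + G e (t - tUnit 1) := by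
  unfold G
  rw [qPoly_update, show qFactor 2 = 1 + X 1 by rfl, mul_add, mul_one, coeffZ_add, mul_comm, coeffZ_X_mul]

/-- **Pascal 4** (`F₄ = 1 + y`): `G(e+u₄, t) = G(e, t) + G(e, t − u_y)`. -/
theorem G_succ3 (e : Fin 7 → ℕ) (t : Fin 5 → ℤ) :
    G (Function.update e 3 (e 3 + 1)) t = G e t + G e (t - tUnit 3) := by
  unfold G
  rw [qPoly_update, show qFactor 3 = 1 + X 3 by rfl, mul_add, mul_one, coeffZ_add, mul_comm, coeffZ_X_mul]

/-- **Pascal 5** (`F₅ = 1 + y'`): `G(e+u₅, t) = G(e, t) + G(e, t − u_{y'})`. -/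
theorem G_succ4 (e : Fin 7 → ℕ) (t : Fin 5 → ℤ) :
    G (Function.update e 4 (e 4 + 1)) t = G e t + G e (t - tUnit 4) := by
  unfold G
  rw [qPoly_update, show qFactor 4 = 1 + X 4 by rfl, mul_add, mul_one, coeffZ_add, mul_comm, coeffZ_X_mul]

/-- **Pascal 6** (`F₆ = 1 + y(1+z)(1+v) = 1 + y·F₂·F₁`): `G(e+u₆, t) = G(e, t) + G(e+u₁+u₂, t − u_y)`. -/
theorem G_succ5 (e : Fin 7 → ℕ) (t : Fin 5 → ℤ) :
    G (Function.update e 5 (e 5 + 1)) t =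
      G e t + G (Function.update (Function.update e 0 (e 0 + 1)) 1 (e 1 + 1)) (t - tUnit 3) := by
  unfold G
  have h1 : qPoly (Function.update (Function.update e 0 (e 0 + 1)) 1 (e 1 + 1)) = qPoly e * qFactor 0 * qFactor 1 := by
    have := qPoly_update (Function.update e 0 (e 0 + 1)) 1
    rw [Function.update_of_ne (by decide : (1 : Fin 7) ≠ 0)] at this
    rw [this, qPoly_update]
  rw [qPoly_update, h1, show qFactor 5 = 1 + X 3 * (1 + X 0) * (1 + X 2) by rfl, show qFactor 0 = 1 + X 2 by rfl,
    show qFactor 1 = 1 + X 0 by rfl, mul_add, mul_one, coeffZ_add,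
    show qPoly e * (X 3 * (1 + X 0) * (1 + X 2)) = X 3 * (qPoly e * (1 + X 2) * (1 + X 0)) by ring, coeffZ_X_mul]

/-- **Pascal 7** (`F₇ = 1 + y'(1+z')(1+v) = 1 + y'·F₃·F₁`): `G(e+u₇, t) = G(e, t) + G(e+u₁+u₃, t − u_{y'})`. -/
theorem G_succ6 (e : Fin 7 → ℕ) (t : Fin 5 → ℤ) :
    G (Function.update e 6 (e 6 + 1)) t =
      G e t + G (Function.update (Function.update e 0 (e 0 + 1)) 2 (e 2 + 1)) (t - tUnit 4) := by
  unfold G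
  have h1 : qPoly (Function.update (Function.update e 0 (e 0 + 1)) 2 (e 2 + 1)) = qPoly e * qFactor 0 * qFactor 2 := by
    have := qPoly_update (Function.update e 0 (e 0 + 1)) 2
    rw [Function.update_of_ne (by decide : (2 : Fin 7) ≠ 0)] at this
    rw [this, qPoly_update]
  rw [qPoly_update, h1, show qFactor 6 = 1 + X 4 * (1 + X 1) * (1 + X 2) by rfl, show qFactor 0 = 1 + X 2 by rfl,
    show qFactor 2 = 1 + X 1 by rfl, mul_add, mul_one, coeffZ_add,
    show qPoly e * (X 4 * (1 + X 1) * (1 + X 2)) = X 4 * (qPoly e * (1 + X 2) * (1 + X 1)) by ring, coeffZ_X_mul]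

/-- **Base value**: `G(0, t) = [t = 0]`. -/
theorem G_zero (t : Fin 5 → ℤ) : G 0 t = if t = 0 then 1 else 0 := by
  unfold G qPoly
  simp only [Pi.zero_apply, pow_zero, mul_one]
  exact coeffZ_one t

/-- `G` vanishes off the non-negative orthant in `t`. -/
theorem G_eq_zero_of_neg (e : Fin 7 → ℕ) (t : Fin 5 → ℤ) (j : Fin 5) (hj : t j < 0) : G e t = 0 := by
  unfold G coeffZ
  rw [if_neg]
  intro h; have := h j; omega

end DualQ

end Summit.KontsevichZagierPeriods.Zeta5Search.Families.Cellular
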